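import Literature.MathematicalPhysics.QuantumFieldTheory.StrongCouplingActivities
import Mathlib.MeasureTheory.Constructions.Pi
import Mathlib.MeasureTheory.Group.Measure
import HarnessLib

/-!
# Planar lattice `YM₂`, layer 2a: telescoping a column of link variables into plaquette variables

Second layer of the lattice half of Driver's lattice-to-continuum theorem for two-dimensional
Yang–Mills (B. K. Driver, CMP **123** (1989) 575–616, §7, Thm 7.4/7.5: in axial gauge the
planar lattice measure makes the plaquette variables independent). In the axial (comb) gauge on
a box of `ℤ²` (`LatticeAxialGauge`: all vertical bonds and the horizontal bonds on the `x`-axis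
are set to `1`), the plaquette based at `(c, j)` has holonomy `h_{j-1} h_j⁻¹`, where
`h_j = U((c, j+1), e₀)` are the horizontal link variables of the column `c` above the axis and
`h_{-1} = 1`. This file treats one such column abstractly, for a group `G` and `n` variables:

* `PlanarYM2.teleDiff a h` — the successive quotients `j ↦ h_{j-1} h_j⁻¹` of `h : Fin n → G`
  started at `h_{-1} := a` (`a = 1` in the application; the general start is what makes the
  induction run: `teleDiff a (cons x h) = cons (a x⁻¹) (teleDiff x h)`, `teleDiff_cons`);
* `PlanarYM2.measurePreserving_teleDiff` — **the change of variables from link to plaquette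
  variables preserves the product Haar measure** (a skew product of two-sided translates of Haar
  variables; Driver 1989, proof of Thm 7.4, "making the change of variables `vᵢuᵢ → vᵢ`", p. 600;
  Chatterjee, arXiv:1602.01222 Lemma 9.3 for the analogous statement about gauge fixing);
* `PlanarYM2.prod_ofFn_teleDiff` — the partial products telescope:
  `(h_{-1}h_0⁻¹)(h_0h_1⁻¹)⋯(h_{m-2}h_{m-1}⁻¹) = a h_{m-1}⁻¹`, which is how the top edge of a
  square loop becomes the ordered product of the plaquette variables below it (non-abelian
  Stokes formula in axial gauge).

Everything is proved; the only definition is the explicit map `teleDiff`; no named facts.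

## References

* B. K. Driver, CMP **123** (1989) 575–616, §7 (Thm 7.4, its proof, Thm 7.5). [DriverCMP1989]
* S. Chatterjee, *The leading term of the Yang–Mills free energy*, JFA 271 (2016),
  arXiv:1602.01222, §9 (axial gauge, Lemma 9.3). [arXiv160201222]
-/

open MeasureTheory Measure

noncomputable section

namespace Literature.MathematicalPhysics.QuantumFieldTheory

namespace PlanarYM2

variable {G : Type*} [Group G]

/-! ### Successive quotients -/

/-- The successive quotients of a column of link variables: for `h : Fin n → G` and a start value
`a` (playing `h_{-1}`), `teleDiff a h j = h_{j-1} h_j⁻¹`, i.e. `(cons a h) (castSucc j) · (h j)⁻¹`.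
In axial gauge these are the plaquette holonomies of the column (Driver 1989, proof of Thm 7.4).
[cite: DriverCMP1989, Thm 7.4 (proof)] -/
def teleDiff {n : ℕ} (a : G) (h : Fin n → G) : Fin n → G :=
  fun j => (Fin.cons a h : Fin (n + 1) → G) (Fin.castSucc j) * (h j)⁻¹

/-- The first quotient is `a h₀⁻¹`. [cite: DriverCMP1989, Thm 7.4 (proof)] -/
@[simp] theorem teleDiff_zero {n : ℕ} (a : G) (h : Fin (n + 1) → G) :
    teleDiff a h 0 = a * (h 0)⁻¹ := by
  simp [teleDiff]

/-- The later quotients are `h_j h_{j+1}⁻¹`. [cite: DriverCMP1989, Thm 7.4 (proof)] -/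
@[simp] theorem teleDiff_succ {n : ℕ} (a : G) (h : Fin (n + 1) → G) (j : Fin n) :
    teleDiff a h j.succ = h (Fin.castSucc j) * (h j.succ)⁻¹ := by
  simp only [teleDiff]
  rw [← Fin.succ_castSucc, Fin.cons_succ]

/-- **Recursion in the first variable**: `teleDiff a (cons x h) = cons (a x⁻¹) (teleDiff x h)`.
[cite: DriverCMP1989, Thm 7.4 (proof)] -/
theorem teleDiff_cons {n : ℕ} (a x : G) (h : Fin n → G) :
    teleDiff a (Fin.cons x h : Fin (n + 1) → G) = Fin.cons (a * x⁻¹) (teleDiff x h) := by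
  funext j
  refine Fin.cases ?_ (fun i => ?_) j
  · simp
  · rw [teleDiff_succ, Fin.cons_succ, Fin.cons_succ]
    simp only [teleDiff]

/-- On zero variables `teleDiff a` is the identity of the one-point space. [folklore] -/
theorem teleDiff_fin_zero (a : G) : teleDiff (n := 0) a = id := by
  funext h j
  exact j.elim0

/-- **Telescoping of the partial products**: for `m ≤ n`,
`∏_{j<m} teleDiff a h j = a · ((cons a h) m)⁻¹` — i.e. `a h_{m-1}⁻¹` for `m ≥ 1` and `1` for
`m = 0` (ordered product, `List.ofFn`). [cite: DriverCMP1989, Thm 7.4 (proof)] -/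
theorem prod_ofFn_teleDiff {n : ℕ} (a : G) (h : Fin n → G) :
    ∀ (m : ℕ) (hm : m ≤ n),
      (List.ofFn fun j : Fin m => teleDiff a h (Fin.castLE hm j)).prod =
        a * ((Fin.cons a h : Fin (n + 1) → G) ⟨m, Nat.lt_succ_of_le hm⟩)⁻¹
  | 0, _ => by simp
  | m + 1, hm => by
    rw [List.ofFn_succ', List.concat_eq_append, List.prod_append, List.prod_singleton]
    have hm' : m ≤ n := Nat.le_of_succ_le hm
    have h1 : (List.ofFn fun j : Fin m => teleDiff a h (Fin.castLE hm (Fin.castSucc j))).prod =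
        a * ((Fin.cons a h : Fin (n + 1) → G) ⟨m, Nat.lt_succ_of_le hm'⟩)⁻¹ :=
      prod_ofFn_teleDiff a h m hm'
    rw [h1]
    -- the last factor is `h_{m-1}' h_m⁻¹` with `h_{m-1}' = (cons a h) m`
    have h2 : teleDiff a h (Fin.castLE hm (Fin.last m)) =
        (Fin.cons a h : Fin (n + 1) → G) ⟨m, Nat.lt_succ_of_le hm'⟩ * (h (Fin.castLE hm (Fin.last m)))⁻¹ := by
      simp only [teleDiff]
      congr 2
    have h3 : (Fin.cons a h : Fin (n + 1) → G) ⟨m + 1, Nat.lt_succ_of_le hm⟩ = h (Fin.castLE hm (Fin.last m)) := by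
      have : (⟨m + 1, Nat.lt_succ_of_le hm⟩ : Fin (n + 1)) = Fin.succ (Fin.castLE hm (Fin.last m)) :=
        Fin.ext (by simp)
      rw [this, Fin.cons_succ]
    rw [h2, h3]
    group

/-! ### Measurability and measure preservation -/

variable [MeasurableSpace G]

section Measurable

variable [TopologicalSpace G] [IsTopologicalGroup G] [BorelSpace G] [SecondCountableTopology G]

/-- Joint measurability of `(a, h) ↦ teleDiff a h` (second countable `G`). [folklore] -/
theorem measurable_teleDiff_uncurry {n : ℕ} :
    Measurable (Function.uncurry (teleDiff (G := G) (n := n))) := by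
  refine measurable_pi_lambda _ fun j => ?_
  cases n with
  | zero => exact j.elim0
  | succ n =>
    refine Fin.cases ?_ (fun i => ?_) j
    · simp only [Function.uncurry, teleDiff_zero]
      exact measurable_fst.mul ((measurable_pi_apply 0).comp measurable_snd).inv
    · simp only [Function.uncurry, teleDiff_succ]
      exact ((measurable_pi_apply _).comp measurable_snd).mul
        ((measurable_pi_apply _).comp measurable_snd).inv

/-- Measurability of `teleDiff a`. [folklore] -/
theorem measurable_teleDiff {n : ℕ} (a : G) : Measurable (teleDiff (n := n) a) :=
  measurable_teleDiff_uncurry.comp (measurable_const.prodMk measurable_id)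

end Measurable

variable [TopologicalSpace G] [IsTopologicalGroup G] [CompactSpace G] [BorelSpace G]
  [SecondCountableTopology G]

/-- **The link-to-plaquette change of variables preserves product Haar measure.** For every start
value `a`, `teleDiff a : G^n → G^n` pushes `∏ dh_j` (Haar probability on each factor) forward to
itself. Induction on `n` through `teleDiff_cons`: on `G × G^{n}` the map is the skew product
`(x, h) ↦ (a x⁻¹, teleDiff x h)` of the Haar-preserving map `x ↦ a x⁻¹` with the fibre maps
`teleDiff x`, which preserve `∏ dh_j` by the induction hypothesis
(`MeasurePreserving.skew_product`). (Driver 1989, proof of Thm 7.4, p. 600: "making the change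
of variables `vᵢuᵢ → vᵢ` and then do the `u`-integrals"; Chatterjee arXiv:1602.01222 Lemma 9.3.)
[cite: DriverCMP1989, Thm 7.4 (proof)] -/
theorem measurePreserving_teleDiff :
    ∀ (n : ℕ) (a : G), MeasurePreserving (teleDiff (n := n) a)
      (Measure.pi fun _ : Fin n => haarProbability G) (Measure.pi fun _ : Fin n => haarProbability G)
  | 0, a => by
    rw [teleDiff_fin_zero]
    exact MeasurePreserving.id _
  | n + 1, a => by
    set μ := haarProbability G with hμ
    set e := MeasurableEquiv.piFinSuccAbove (fun _ : Fin (n + 1) => G) 0 with he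
    have hme : MeasurePreserving e (Measure.pi fun _ : Fin (n + 1) => μ)
        (μ.prod (Measure.pi fun _ : Fin n => μ)) :=
      measurePreserving_piFinSuccAbove (fun _ : Fin (n + 1) => μ) 0
    -- the skew product on `G × G^n`
    set Φ : G × (Fin n → G) → G × (Fin n → G) := fun p => (a * p.1⁻¹, teleDiff p.1 p.2) with hΦ
    have hf : MeasurePreserving (fun x : G => a * x⁻¹) μ μ :=
      (measurePreserving_mul_left μ a).comp (measurePreserving_inv μ)
    have hΦp : MeasurePreserving Φ (μ.prod (Measure.pi fun _ : Fin n => μ))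
        (μ.prod (Measure.pi fun _ : Fin n => μ)) :=
      hf.skew_product measurable_teleDiff_uncurry
        (ae_of_all _ fun x => (measurePreserving_teleDiff n x).map_eq)
    -- `teleDiff a = e⁻¹ ∘ Φ ∘ e`
    have hcomp : teleDiff (n := n + 1) a = e.symm ∘ Φ ∘ e := by
      funext h
      have hh : h = Fin.cons (h 0) (Fin.tail h) := (Fin.cons_self_tail h).symm
      conv_lhs => rw [hh, teleDiff_cons]
      simp only [Function.comp_apply, he, hΦ, MeasurableEquiv.piFinSuccAbove_apply,
        MeasurableEquiv.piFinSuccAbove_symm_apply, Fin.insertNthEquiv, Equiv.coe_fn_symm_mk,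
        Equiv.coe_fn_mk, Fin.insertNth_zero']
      rfl
    rw [hcomp]
    exact hme.symm.comp (hΦp.comp hme)

/-- Change of variables in integrals: for every `Φ`,
`∫ Φ (teleDiff a h) ∏ dh_j = ∫ Φ (t) ∏ dt_j`. [cite: DriverCMP1989, Thm 7.4 (proof)] -/
theorem integral_comp_teleDiff {E : Type*} [NormedAddCommGroup E] [NormedSpace ℝ E] {n : ℕ}
    (a : G) {Φ : (Fin n → G) → E}
    (hΦ : AEStronglyMeasurable Φ (Measure.pi fun _ : Fin n => haarProbability G)) :
    ∫ h, Φ (teleDiff a h) ∂(Measure.pi fun _ : Fin n => haarProbability G) =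
      ∫ t, Φ t ∂(Measure.pi fun _ : Fin n => haarProbability G) := by
  have hmp := measurePreserving_teleDiff (G := G) n a
  rw [← integral_map hmp.measurable.aemeasurable (by rwa [hmp.map_eq]), hmp.map_eq]

end PlanarYM2

end Literature.MathematicalPhysics.QuantumFieldTheory
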